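import Summits.CriticalPhenomena.PercolationContinuityZ3.Theorems.PercNearOneGluingNoHeavyQuantLongTailTripleTopAlg
import Summits.CriticalPhenomena.PercolationContinuityZ3.Theorems.PercNearOneGluingNoHeavyQuantLongTailTripleTopAlgTwo
import Summits.CriticalPhenomena.PercolationContinuityZ3.Theorems.PercNearOneGluingNoHeavyQuantLongTailTripleTopAlgThree
import Summits.CriticalPhenomena.PercolationContinuityZ3.Theorems.PercNearOneGluingNoHeavyQuantLongTailTripleTopAlgFour
import Summits.CriticalPhenomena.PercolationContinuityZ3.Theorems.PercNearOneGluingNoHeavyQuantLongTailTripleTopAlgFourTwo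
import Summits.CriticalPhenomena.PercolationContinuityZ3.Theorems.PercNearOneGluingNoHeavyQuantLongTailTripleTopAlgFourThree
import Summits.CriticalPhenomena.PercolationContinuityZ3.Theorems.PercNearOneGluingNoHeavyQuantLongTailTripleTopAlgFourFour
import HarnessLib

/-!
# QUANT lane R8, T-DEC: LONG-TAIL TRIPLE HUB — the top-route closed forms on the WHOLE RANGE `3lo ≤ K ≤ 4lo` (census-1 gen 33)

builds on p205010 (kernel theorem, internal audit signed; external expert review pending)

Support file (`--supports stmt-CriticalPhenomena-4575`), QUANT lane seat prim-quant-census-1 (gen 33); memo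
`run/shared/lean/prim/quant/prim-quant-census-1/g33/WIDE3-G33.md` §2.  Theorems only, standard axioms, no sorries.  Bookkeeping: each `ltTopW_*` is the
case split `2K ≤ 7lo` (gen 32's certificate `ltTop_*`, `…QuantLongTailTripleTopAlg*`) / `7lo ≤ 2K` (this generation's certificate `ltTop4_*`,
`…QuantLongTailTripleTopAlgFour*`), with the union of the two hypothesis lists — the bricks of the `K ≤ 4lo` route files `…QuantLongTailTripleWide4*`.
The floor cost at `T = 6lo+2K` (`ltTopW_cost2_max`) splits `lo/K < 2/7` further into the three boxes of `…QuantLongTailTripleTopAlgFourThree/FourFour`.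
* `ltTopW_capRho_one`, `ltTopW_costRho_oneA`, `ltTopW_cost0_max`, `ltTopW_capTop_oneQ` (one low); `ltTopW_capRho_two`, `ltTopW_capTop_two`,
  `ltTopW_costRho_two`, `ltTopW_cost2_max` (two lows).

HONEST STATUS.  Algebra only; `SiblingStep`, `GluedDominatedMass`, `SDECConvClosed`, `FarTreeRow` OPEN; RATE class (log\*) / honest sentence of
`run/shared/lean/prim/quant/README.md` unchanged.  [this work].  Nothing here is cited as a published result.  The gluing rows served
[cite: KozmaNitzan2024, Conjecture 3 (p. 15)]; product measure [cite: Grimmett1999, §1.3 p. 10].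
-/

noncomputable section

namespace Summit.CriticalPhenomena.PercolationContinuityZ3.Theorems
namespace Quant
namespace LawDec

/-- **top capacity, ρ-part, one low, `3lo ≤ K ≤ 4lo`**: `D(u₀+u₃) ≤ 3K·u₃` under the exhausted credit (`ltTop_capRho_one` for `2K ≤ 7lo`,
`ltTop4_capRho_one` for `7lo ≤ 2K`). [this work] -/
theorem ltTopW_capRho_one (lo K g₁ g₂ g₃ D : ℝ) (hlo : 0 < lo) (hK1 : 3 * lo ≤ K) (hK2 : K ≤ 4 * lo)
    (hg₁ : lo ≤ K * g₁) (hg₂ : lo ≤ K * g₂) (hg₃ : lo ≤ K * g₃) (h11 : g₁ ≤ 1) (h21 : g₂ ≤ 1) (h31 : g₃ ≤ 1)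
    (hD : 0 ≤ D) (hD2' : D ≤ 2 * K) (hDL' : D ≤ K * (g₁ + g₂ + g₃) - 3 * lo)
    (hcr : K * (g₁ * (1 - g₂) * (1 - g₃) + g₂ * (1 - g₁) * (1 - g₃) + g₃ * (1 - g₁) * (1 - g₂))
      ≤ D * ((1 - g₁) * (1 - g₂) * (1 - g₃) + (g₁ * (1 - g₂) * (1 - g₃) + g₂ * (1 - g₁) * (1 - g₃) + g₃ * (1 - g₁) * (1 - g₂)))) :
    D * ((1 - g₁) * (1 - g₂) * (1 - g₃) + (g₁ * g₂ * g₃))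
      ≤ 3 * K * (g₁ * g₂ * g₃) := by
  rcases le_total (2 * K) (7 * lo) with h7 | h7
  · exact ltTop_capRho_one lo K g₁ g₂ g₃ D hlo hK1 h7 hg₁ hg₂ hg₃ h11 h21 h31 hD hD2' hDL' hcr
  · exact ltTop4_capRho_one lo K g₁ g₂ g₃ D hlo h7 hK2 hg₁ hg₂ hg₃ h11 h21 h31 hD hD2' hDL' hcr

/-- **top cost, ρ-part, one low, `3lo+2K` above `T`, `3lo ≤ K ≤ 4lo`**: `(3K−3lo−D)·D·u₀ ≤ (3K−D)(u₀(D+3lo) + u₁(D+3lo−K))`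
(`ltTop_costRho_oneA` / `ltTop4_costRho_oneA`). [this work] -/
theorem ltTopW_costRho_oneA (lo K g₁ g₂ g₃ D : ℝ) (hlo : 0 < lo) (hK1 : 3 * lo ≤ K) (hK2 : K ≤ 4 * lo)
    (hg₁ : lo ≤ K * g₁) (hg₂ : lo ≤ K * g₂) (hg₃ : lo ≤ K * g₃) (h11 : g₁ ≤ 1) (h21 : g₂ ≤ 1) (h31 : g₃ ≤ 1)
    (hD : 0 ≤ D) (hT1' : K ≤ D + 3 * lo) (hT2' : D + 3 * lo ≤ 2 * K) (_hDL' : D ≤ K * (g₁ + g₂ + g₃) - 3 * lo)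
    (hcr : K * (g₁ * (1 - g₂) * (1 - g₃) + g₂ * (1 - g₁) * (1 - g₃) + g₃ * (1 - g₁) * (1 - g₂))
      ≤ D * ((1 - g₁) * (1 - g₂) * (1 - g₃) + (g₁ * (1 - g₂) * (1 - g₃) + g₂ * (1 - g₁) * (1 - g₃) + g₃ * (1 - g₁) * (1 - g₂)))) :
    (3 * K - 3 * lo - D) * D * ((1 - g₁) * (1 - g₂) * (1 - g₃))
      ≤ (3 * K - D) * ((1 - g₁) * (1 - g₂) * (1 - g₃) * (D + 3 * lo) + (g₁ * (1 - g₂) * (1 - g₃) + g₂ * (1 - g₁) * (1 - g₃) + g₃ * (1 - g₁) * (1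
          - g₂)) * (D + 3 * lo - K)) := by
  rcases le_total (2 * K) (7 * lo) with h7 | h7
  · exact ltTop_costRho_oneA lo K g₁ g₂ g₃ D hlo hK1 h7 hg₂ hg₃ h11 h21 h31 hD hT1' hT2' hcr
  · exact ltTop4_costRho_oneA lo K g₁ g₂ g₃ D hlo h7 hK2 hg₁ hg₂ h11 h21 h31 hD hT1' hT2' hcr

/-- **top cost at the switching point, largest floor, `3lo ≤ K ≤ 4lo`** (`g₁` the least gate):
`(lo+Kg₁)·u₀·[(3K−3lo)u₀ + (2K−3lo)u₁] ≤ 3loK(1−g₁)(u₀+u₁)²` (`ltTop_cost0_max` / `ltTop4_cost0_max`). [this work] -/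
theorem ltTopW_cost0_max (lo K g₁ g₂ g₃ : ℝ) (hlo : 0 < lo) (hK1 : 3 * lo ≤ K) (hK2 : K ≤ 4 * lo)
    (hg₁ : lo ≤ K * g₁) (h12 : g₁ ≤ g₂) (h13 : g₁ ≤ g₃) (h11 : g₁ ≤ 1) (h21 : g₂ ≤ 1) (h31 : g₃ ≤ 1) :
    (lo + K * g₁) * (((1 - g₁) * (1 - g₂) * (1 - g₃)) * ((3 * K - 3 * lo) * ((1 - g₁) * (1 - g₂) * (1 - g₃)) + (2 * K - 3 * lo) * (g₁ * (1 - g₂) * (1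
          - g₃) + g₂ * (1 - g₁) * (1 - g₃) + g₃ * (1 - g₁) * (1 - g₂))))
      ≤ 3 * lo * K * (1 - g₁) * ((1 - g₁) * (1 - g₂) * (1 - g₃) + (g₁ * (1 - g₂) * (1 - g₃) + g₂ * (1 - g₁) * (1 - g₃) + g₃ * (1 - g₁) * (1
          - g₂))) ^ 2 := by
  rcases le_total (2 * K) (7 * lo) with h7 | h7
  · exact ltTop_cost0_max lo K g₁ g₂ g₃ hlo hK1 h7 hg₁ h12 h13 h11 h21 h31
  · exact ltTop4_cost0_max lo K g₁ g₂ g₃ hlo h7 hK2 hg₁ h12 h13 h11 h21 h31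

/-- **top capacity, floor part, one low, at the largest floor, THREE-BRANCH premise, `3lo ≤ K ≤ 4lo`** (`g₁` the least gate):
`(lo+Kg₁)(u₀+u₃) ≤ (lo+K)u₃` (`ltTop_capTop_oneQ` / `ltTop4_capTop_oneQ`). [this work] -/
theorem ltTopW_capTop_oneQ (lo K g₁ g₂ g₃ : ℝ) (hlo : 0 < lo) (hK1 : 3 * lo ≤ K) (hK2 : K ≤ 4 * lo)
    (hg₁ : lo ≤ K * g₁) (hg₂ : lo ≤ K * g₂) (hg₃ : lo ≤ K * g₃) (h12 : g₁ ≤ g₂) (h13 : g₁ ≤ g₃)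
    (h11 : g₁ ≤ 1) (h21 : g₂ ≤ 1) (h31 : g₃ ≤ 1)
    (hcr0 : K * (g₁ * (1 - g₂) * (1 - g₃) + g₂ * (1 - g₁) * (1 - g₃) + g₃ * (1 - g₁) * (1 - g₂))
      ≤ (K * (g₁ + g₂ + g₃) - 3 * lo) * ((1 - g₁) * (1 - g₂) * (1 - g₃) + (g₁ * (1 - g₂) * (1 - g₃) + g₂ * (1 - g₁) * (1 - g₃) + g₃ * (1 - g₁) * (1
          - g₂))))
    (hcap2 : 2 * K * (g₁ * g₂ * (1 - g₃) + g₁ * g₃ * (1 - g₂) + g₂ * g₃ * (1 - g₁))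
      ≤ (K * (g₁ + g₂ + g₃) - 3 * lo) * ((1 - g₁) * (1 - g₂) * (1 - g₃) + (g₁ * g₂ * (1 - g₃) + g₁ * g₃ * (1 - g₂) + g₂ * g₃ * (1 - g₁)))) :
    (lo + K * g₁) * ((1 - g₁) * (1 - g₂) * (1 - g₃) + (g₁ * g₂ * g₃))
      ≤ (lo + K) * (g₁ * g₂ * g₃) := by
  rcases le_total (2 * K) (7 * lo) with h7 | h7
  · exact ltTop_capTop_oneQ lo K g₁ g₂ g₃ hlo hK1 h7 hg₁ hg₂ hg₃ h12 h13 h11 h21 h31 hcr0 hcap2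
  · exact ltTop4_capTop_oneQ lo K g₁ g₂ g₃ hlo h7 hK2 hg₁ hg₂ hg₃ h12 h13 h11 h21 h31 hcr0 hcap2

/-- **top capacity, ρ-part, two lows, `3lo ≤ K ≤ 4lo`** (`2K ≤ D ≤ K(g₁+g₂+g₃) − 3lo`): `D(u₀+u₁+u₃) ≤ 3K·u₃`
(`ltTop_capRho_two` / `ltTop4_capRho_two`). [this work] -/
theorem ltTopW_capRho_two (lo K g₁ g₂ g₃ D : ℝ) (hlo : 0 < lo) (hK1 : 3 * lo ≤ K) (hK2 : K ≤ 4 * lo)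
    (hg₁ : lo ≤ K * g₁) (hg₂ : lo ≤ K * g₂) (hg₃ : lo ≤ K * g₃) (h11 : g₁ ≤ 1) (h21 : g₂ ≤ 1) (h31 : g₃ ≤ 1)
    (hD2' : 2 * K ≤ D) (hDL' : D ≤ K * (g₁ + g₂ + g₃) - 3 * lo) :
    D * ((1 - g₁) * (1 - g₂) * (1 - g₃) + (g₁ * (1 - g₂) * (1 - g₃) + g₂ * (1 - g₁) * (1 - g₃) + g₃ * (1 - g₁) * (1 - g₂)) + (g₁ * g₂ * g₃))
      ≤ 3 * K * (g₁ * g₂ * g₃) := by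
  rcases le_total (2 * K) (7 * lo) with h7 | h7
  · exact ltTop_capRho_two lo K g₁ g₂ g₃ D hlo hK1 h7 hg₁ hg₂ hg₃ h11 h21 h31 hD2' hDL'
  · exact ltTop4_capRho_two lo K g₁ g₂ g₃ D hlo h7 hK2 hg₁ hg₂ hg₃ h11 h21 h31 hD2' hDL'

/-- **top capacity, floor part, two lows, `3lo ≤ K ≤ 4lo`** (`g₁` the least gate, `2K ≤ K(g₁+g₂+g₃) − 3lo`): `(lo+Kg₁)(u₀+u₁+u₃) ≤ (lo+K)u₃`
(`ltTop_capTop_two` / `ltTop4_capTop_two`). [this work] -/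
theorem ltTopW_capTop_two (lo K g₁ g₂ g₃ : ℝ) (hlo : 0 < lo) (hK1 : 3 * lo ≤ K) (hK2 : K ≤ 4 * lo)
    (hg₁ : lo ≤ K * g₁) (hg₂ : lo ≤ K * g₂) (hg₃ : lo ≤ K * g₃) (h12 : g₁ ≤ g₂) (h13 : g₁ ≤ g₃)
    (h11 : g₁ ≤ 1) (h21 : g₂ ≤ 1) (h31 : g₃ ≤ 1) (hL2' : 2 * K ≤ K * (g₁ + g₂ + g₃) - 3 * lo) :
    (lo + K * g₁) * ((1 - g₁) * (1 - g₂) * (1 - g₃) + (g₁ * (1 - g₂) * (1 - g₃) + g₂ * (1 - g₁) * (1 - g₃) + g₃ * (1 - g₁) * (1 - g₂))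
          + (g₁ * g₂ * g₃))
      ≤ (lo + K) * (g₁ * g₂ * g₃) := by
  rcases le_total (2 * K) (7 * lo) with h7 | h7
  · exact ltTop_capTop_two lo K g₁ g₂ g₃ hlo hK1 h7 hg₁ hg₂ hg₃ h12 h13 h11 h21 h31 hL2'
  · exact ltTop4_capTop_two lo K g₁ g₂ g₃ hlo h7 hK2 hg₁ hg₂ hg₃ h12 h13 h11 h21 h31 hL2'

/-- **top cost, ρ-part, two lows, `3lo ≤ K ≤ 4lo`** (`2K ≤ D ≤ K(g₁+g₂+g₃) − 3lo`):
`(3K−3lo−D)·D·(u₀+u₁) ≤ (3K−D)(u₀(D+3lo) + u₁(D+3lo−K) + u₂(D+3lo−2K))` (`ltTop_costRho_two` / `ltTop4_costRho_two`). [this work] -/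
theorem ltTopW_costRho_two (lo K g₁ g₂ g₃ D : ℝ) (hlo : 0 < lo) (hK1 : 3 * lo ≤ K) (hK2 : K ≤ 4 * lo)
    (hg₁ : lo ≤ K * g₁) (_hg₂ : lo ≤ K * g₂) (hg₃ : lo ≤ K * g₃) (h11 : g₁ ≤ 1) (h21 : g₂ ≤ 1) (h31 : g₃ ≤ 1)
    (hD2' : 2 * K ≤ D) (hDL' : D ≤ K * (g₁ + g₂ + g₃) - 3 * lo) :
    (3 * K - 3 * lo - D) * D * ((1 - g₁) * (1 - g₂) * (1 - g₃) + (g₁ * (1 - g₂) * (1 - g₃) + g₂ * (1 - g₁) * (1 - g₃) + g₃ * (1 - g₁) * (1 - g₂)))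
      ≤ (3 * K - D) * ((1 - g₁) * (1 - g₂) * (1 - g₃) * (D + 3 * lo) + (g₁ * (1 - g₂) * (1 - g₃) + g₂ * (1 - g₁) * (1 - g₃) + g₃ * (1 - g₁) * (1
          - g₂)) * (D + 3 * lo - K) + (g₁ * g₂ * (1 - g₃) + g₁ * g₃ * (1 - g₂) + g₂ * g₃ * (1 - g₁)) * (D + 3 * lo - 2 * K)) := by
  rcases le_total (2 * K) (7 * lo) with h7 | h7
  · exact ltTop_costRho_two lo K g₁ g₂ g₃ D hlo hK1 h7 hg₁ hg₃ h11 h21 h31 hD2' hDL'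
  · exact ltTop4_costRho_two lo K g₁ g₂ g₃ D hlo h7 hK2 hg₁ hg₃ h11 h21 h31 hD2' hDL'

/-- **top cost, floor part, at `T = 6lo+2K`, largest floor, `3lo ≤ K ≤ 4lo`** (`g₁` the least gate, `2K ≤ K(g₁+g₂+g₃) − 3lo`):
`(K−3lo)(lo+Kg₁)(6lo+2K)(u₀+u₁) ≤ ((3lo+K(g₁+g₂+g₃))(lo+K) − (lo+Kg₁)(6lo+2K))·(u₀(3lo+2K)+u₁(3lo+K)+3lo·u₂)` — gen 32's `ltTop_cost2_max`
(`2K ≤ 7lo`) and the three boxes `ltTop4_cost2_max_a/b/c` below `2/7`. [this work] -/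
theorem ltTopW_cost2_max (lo K g₁ g₂ g₃ : ℝ) (hlo : 0 < lo) (hK1 : 3 * lo ≤ K) (hK2 : K ≤ 4 * lo)
    (hg₁ : lo ≤ K * g₁) (hg₂ : lo ≤ K * g₂) (hg₃ : lo ≤ K * g₃) (h12 : g₁ ≤ g₂) (h13 : g₁ ≤ g₃)
    (h11 : g₁ ≤ 1) (h21 : g₂ ≤ 1) (h31 : g₃ ≤ 1) (hL2' : 2 * K ≤ K * (g₁ + g₂ + g₃) - 3 * lo) :
    (K - 3 * lo) * (lo + K * g₁) * (6 * lo + 2 * K) * ((1 - g₁) * (1 - g₂) * (1 - g₃) + (g₁ * (1 - g₂) * (1 - g₃) + g₂ * (1 - g₁) * (1 - g₃)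
          + g₃ * (1 - g₁) * (1 - g₂)))
      ≤ ((3 * lo + K * (g₁ + g₂ + g₃)) * (lo + K) - (lo + K * g₁) * (6 * lo + 2 * K)) * ((1 - g₁) * (1 - g₂) * (1 - g₃) * (3 * lo + 2 * K) + (g₁ * (1
          - g₂) * (1 - g₃) + g₂ * (1 - g₁) * (1 - g₃) + g₃ * (1 - g₁) * (1 - g₂)) * (3 * lo + K) + (g₁ * g₂ * (1 - g₃) + g₁ * g₃ * (1 - g₂) + g₂ * g₃ * (1 - g₁)) * (3 * lo)) := by
  rcases le_total (2 * K) (7 * lo) with h7 | h7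
  · exact ltTop_cost2_max lo K g₁ g₂ g₃ hlo hK1 h7 hg₁ hg₂ hg₃ h12 h13 h11 h21 h31 hL2'
  · rcases le_total (112 * lo) (31 * K) with h31K | h31K
    · rcases le_total (56 * lo) (15 * K) with h15K | h15K
      · exact ltTop4_cost2_max_a lo K g₁ g₂ g₃ hlo h15K hK2 hg₁ hg₂ hg₃ h12 h13 h11 h21 h31 hL2'
      · exact ltTop4_cost2_max_b lo K g₁ g₂ g₃ hlo h31K h15K hg₁ hg₂ hg₃ h12 h13 h11 h21 h31 hL2'
    · exact ltTop4_cost2_max_c lo K g₁ g₂ g₃ hlo (by linarith) h31K hg₁ hg₂ hg₃ h12 h13 h11 h21 h31 hL2'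

end LawDec
end Quant
end Summit.CriticalPhenomena.PercolationContinuityZ3.Theorems
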